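import Summits.HodgeConjecture.HodgeConjecture.Theorems.H413TowerConj
import Summits.HodgeConjecture.HodgeCM.Model.TowerAlgebra
import Summits.HodgeConjecture.CorCM.Hyp413.A3Liu413FaceTypes
import HarnessLib

/-!
# FLOOR-0 P4, stub T2b AT THE PIN — `StubT2bTowerConjugationAt` verbatim: complex conjugation on `(datum413 …).HB τ'`

Cell hodgecm-mathlib (D-0151), FLOOR 0, crux item H413 = stmt-HodgeConjecture-24833; programme P4, planner line of record
`Cruxes/H413/Lines/F0_P4AdmissibleOccursInH1.lean` (F0P4-plan (g0), rf sha16 98373f7d; ed. 1.1 e5b40b47 keeps this stub byte-identical, block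
38c279a5), stub `stub_T2b_towerConjugationAt` / type `StubT2bTowerConjugationAt` (:243).  Author A-p19 (g15).
`--supports stmt-HodgeConjecture-24833 --as helper`.

`towerConjugationAt_pin` is the stub TYPE token for token (the two idle binders `h6`, `hΦ` carried as `_h6`, `_hΦ` — the same type up to
renaming), so the line's hole folds by `theorem stub_T2b_towerConjugationAt : StubT2bTowerConjugationAt := towerConjugationAt_pin`.
Proof: the pin's `HB τ'` IS binder-1's tower `HodgeCM.Model.TowerCarrier.Tower … V` at the universe records of record (`datum413` ∘ `prop413Data` ∘
`liuDictionaryPin` ∘ `LiuDictionary.ofTower`, all `rfl`, exactly as in A-p13 (g21)'s `exists_holClassMap_pin`), its `rhoB τ' = Representation.ofModule'`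
acts by `MonoidAlgebra.of ℂ _ g • · = act g` (★ `ofModule'_apply_eq_of_smul`, ★ `TowerCarrier.of_smul_eq_act`), and the three clauses are
`conjT_injective`, `conjT_act`, `eq_zero_of_mem_H10T_of_conjT_eq` of `Theorems/H413TowerConj.lean` (the stub's inline `(1,0)`-part IS `H10T … V`).
HC_CM is proved only modulo the 7 printed citations until rung 0 closes; this file proves nothing about them.
[cite: DeligneHodgeII1971, 1.2.5 and 2.1.4] [cite: VoisinHodgeI2002, §7.1] [cite: BorelWallach2000, VII 2.10]

## References
* [DeligneHodgeII1971] P. Deligne, *Théorie de Hodge II*, Publ. Math. IHÉS 40 (1971), 1.2.5, 2.1.4.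
* [VoisinHodgeI2002] C. Voisin, *Hodge Theory and Complex Algebraic Geometry I*, §7.1.  [BorelWallach2000] A. Borel, N. Wallach, VII 2.10.
* Tree: `Theorems/H413TowerConj` (this seat), ★ `CorCM/Hyp413/A3Liu413FaceTypes` (`datum413`), HodgeCM `Model/TowerAlgebra` (`of_smul_eq_act`),
  ★ `Literature/RepresentationTheory/Semisimple/EquivariantIrreducibleDecomposition` (`ofModule'_apply_eq_of_smul`).
-/

set_option autoImplicit false
set_option linter.dupNamespace false

noncomputable section

open MulAction NumberField NumberField.InfinitePlace
open HodgeCM HodgeCM.Model HodgeCM.Model.LiuIndex HodgeCM.Model.TowerCarrier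
open Summit.HodgeConjecture.CorCM.Model
open Literature.AlgebraicGeometry.Motives (CMType)
open Literature.AlgebraicGeometry.HodgeTheory Literature.NumberTheory.Automorphic.PicardCM
open Literature.AlgebraicGeometry.ShimuraVarieties Literature.AlgebraicGeometry.ShimuraVarieties.UnitaryCanonicalModel
open Literature.NumberTheory.ComplexMultiplication
open Literature.NumberTheory.Automorphic
open Literature.NumberTheory.Automorphic.Liu2021 Literature.NumberTheory.Automorphic.Liu2021.AppendixC
open Literature.NumberTheory.GelbartRogawski1991
open Summit.HodgeConjecture.CorCM Summit.HodgeConjecture.CorCM.Transposition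
open Summit.HodgeConjecture.CorCM.Lines.A3Liu413 (datum413)
open Summit.HodgeConjecture.HodgeConjecture.Cruxes.H413.TowerConj

namespace Summit.HodgeConjecture.HodgeConjecture.Cruxes.H413.TowerConj

set_option synthInstance.maxHeartbeats 400000 in
set_option maxHeartbeats 8000000 in
/-- **Stub T2b `StubT2bTowerConjugationAt`, verbatim, AT THE PIN**: for every face and every `τ'`, an INJECTIVE conjugate-linear `cB` on the pin's
`H¹_{B,τ'}(A_∞, ℂ)` commuting with `rhoB τ'` and such that the `(1,0)`-part of the tower meets `cB` of itself only in `0`; `cB := conjT` of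
`Theorems/H413TowerConj.lean` at the universe records of record. [cite: DeligneHodgeII1971, 1.2.5 and 2.1.4] [cite: VoisinHodgeI2002, §7.1]
[cite: BorelWallach2000, VII 2.10] -/
theorem towerConjugationAt_pin :
  ∀ (hDel : Literature.AlgebraicGeometry.ShimuraVarieties.UnitaryCanonicalModel.canonicalModel_exists_printed)
      (F : HodgeCM.CMField) [IsGalois ℚ F] (_h6 : 6 ≤ Module.finrank ℚ F) {ι₁ : F →+* ℂ} (V : HodgeCM.HermSpace3 F ι₁) (a₀ : RealScalar F)
      (Φ : CMType F) (_hΦ : ι₁ ∈ Φ.1) (i : (I V (repAt a₀) (muLiu ι₁ GramClass.rep))),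
      ∀ τ' : HodgeCM.CMField.K F →+* ℂ,
        ∃ cB : (datum413 hDel F V a₀ Φ i).HB τ' →ₛₗ[starRingEnd ℂ] (datum413 hDel F V a₀ Φ i).HB τ',
          Function.Injective cB ∧
            (∀ (g : ↥(HodgeCM.HermSpace3.adelicFin V)) (x : (datum413 hDel F V a₀ Φ i).HB τ'),
                cB ((datum413 hDel F V a₀ Φ i).rhoB τ' g x) = (datum413 hDel F V a₀ Φ i).rhoB τ' g (cB x)) ∧
            ∀ x y : (datum413 hDel F V a₀ Φ i).HB τ',
              x ∈ (⨆ j : HodgeCM.TLvl V,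
                ((Submodule.pi Set.univ fun h : ↥(HodgeCM.HermSpace3.adelicFin V) =>
                      ((HodgeCM.Model.universeOf exists_isReal_hodgeModel_holds hodgePQ_independent_of_hodgeModel_holds (ballQuotientUniformisedDatum_of BallQuotient.ballQuotientUniformised_holds) (cmAbelianVarietyRealised_of_eigenbasis exists_isReal_hodgeModel_holds hodgePQ_independent_of_hodgeModel_holds cmAbelianVarietyEigenbasisRealised_holds)).hodge
                          ((HodgeCM.Model.universeOf exists_isReal_hodgeModel_holds hodgePQ_independent_of_hodgeModel_holds (ballQuotientUniformisedDatum_of BallQuotient.ballQuotientUniformised_holds) (cmAbelianVarietyRealised_of_eigenbasis exists_isReal_hodgeModel_holds hodgePQ_independent_of_hodgeModel_holds cmAbelianVarietyEigenbasisRealised_holds)).pms F ι₁ V (j.1.conj h j.2)) 1).F 1).comap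
                    (HodgeCM.Model.TowerLevel.towerLevel exists_isReal_hodgeModel_holds hodgePQ_independent_of_hodgeModel_holds (ballQuotientUniformisedDatum_of BallQuotient.ballQuotientUniformised_holds) (cmAbelianVarietyRealised_of_eigenbasis exists_isReal_hodgeModel_holds hodgePQ_independent_of_hodgeModel_holds cmAbelianVarietyEigenbasisRealised_holds) Literature.NumberTheory.Transcendental.arapura2012_cor_15_4_6_holds j.1 j.2).subtype).map
                  (HodgeCM.Model.TowerCarrier.ofLevel exists_isReal_hodgeModel_holds hodgePQ_independent_of_hodgeModel_holds (ballQuotientUniformisedDatum_of BallQuotient.ballQuotientUniformised_holds) (cmAbelianVarietyRealised_of_eigenbasis exists_isReal_hodgeModel_holds hodgePQ_independent_of_hodgeModel_holds cmAbelianVarietyEigenbasisRealised_holds) Literature.NumberTheory.Transcendental.arapura2012_cor_15_4_6_holds j.1 j.2) :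
                Submodule ℂ ((datum413 hDel F V a₀ Φ i).HB τ')) →
              y ∈ (⨆ j : HodgeCM.TLvl V,
                ((Submodule.pi Set.univ fun h : ↥(HodgeCM.HermSpace3.adelicFin V) =>
                      ((HodgeCM.Model.universeOf exists_isReal_hodgeModel_holds hodgePQ_independent_of_hodgeModel_holds (ballQuotientUniformisedDatum_of BallQuotient.ballQuotientUniformised_holds) (cmAbelianVarietyRealised_of_eigenbasis exists_isReal_hodgeModel_holds hodgePQ_independent_of_hodgeModel_holds cmAbelianVarietyEigenbasisRealised_holds)).hodge
                          ((HodgeCM.Model.universeOf exists_isReal_hodgeModel_holds hodgePQ_independent_of_hodgeModel_holds (ballQuotientUniformisedDatum_of BallQuotient.ballQuotientUniformised_holds) (cmAbelianVarietyRealised_of_eigenbasis exists_isReal_hodgeModel_holds hodgePQ_independent_of_hodgeModel_holds cmAbelianVarietyEigenbasisRealised_holds)).pms F ι₁ V (j.1.conj h j.2)) 1).F 1).comap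
                    (HodgeCM.Model.TowerLevel.towerLevel exists_isReal_hodgeModel_holds hodgePQ_independent_of_hodgeModel_holds (ballQuotientUniformisedDatum_of BallQuotient.ballQuotientUniformised_holds) (cmAbelianVarietyRealised_of_eigenbasis exists_isReal_hodgeModel_holds hodgePQ_independent_of_hodgeModel_holds cmAbelianVarietyEigenbasisRealised_holds) Literature.NumberTheory.Transcendental.arapura2012_cor_15_4_6_holds j.1 j.2).subtype).map
                  (HodgeCM.Model.TowerCarrier.ofLevel exists_isReal_hodgeModel_holds hodgePQ_independent_of_hodgeModel_holds (ballQuotientUniformisedDatum_of BallQuotient.ballQuotientUniformised_holds) (cmAbelianVarietyRealised_of_eigenbasis exists_isReal_hodgeModel_holds hodgePQ_independent_of_hodgeModel_holds cmAbelianVarietyEigenbasisRealised_holds) Literature.NumberTheory.Transcendental.arapura2012_cor_15_4_6_holds j.1 j.2) :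
                Submodule ℂ ((datum413 hDel F V a₀ Φ i).HB τ')) →
              cB y = x → x = 0 := by

  intro hDel F _ _h6 ι₁ V a₀ Φ _hΦ i τ'
  refine ⟨conjT exists_isReal_hodgeModel_holds hodgePQ_independent_of_hodgeModel_holds
      (ballQuotientUniformisedDatum_of BallQuotient.ballQuotientUniformised_holds)
      (cmAbelianVarietyRealised_of_eigenbasis exists_isReal_hodgeModel_holds hodgePQ_independent_of_hodgeModel_holds
        cmAbelianVarietyEigenbasisRealised_holds)
      Literature.NumberTheory.Transcendental.arapura2012_cor_15_4_6_holds V,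
    conjT_injective _ _ _ _ _, fun g x => ?_, fun x y hx hy hyx => eq_zero_of_mem_H10T_of_conjT_eq _ _ _ _ _ hx hy hyx⟩
  -- the pin's `rhoB τ' = Representation.ofModule'` acts on the tower by `of g • · = act g`
  have h2 : ∀ z : Tower exists_isReal_hodgeModel_holds hodgePQ_independent_of_hodgeModel_holds
      (ballQuotientUniformisedDatum_of BallQuotient.ballQuotientUniformised_holds)
      (cmAbelianVarietyRealised_of_eigenbasis exists_isReal_hodgeModel_holds hodgePQ_independent_of_hodgeModel_holds
        cmAbelianVarietyEigenbasisRealised_holds)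
      Literature.NumberTheory.Transcendental.arapura2012_cor_15_4_6_holds V,
      Representation.ofModule' (k := ℂ) (G := ↥(HodgeCM.HermSpace3.adelicFin V)) _ g z =
        act exists_isReal_hodgeModel_holds hodgePQ_independent_of_hodgeModel_holds
          (ballQuotientUniformisedDatum_of BallQuotient.ballQuotientUniformised_holds)
          (cmAbelianVarietyRealised_of_eigenbasis exists_isReal_hodgeModel_holds hodgePQ_independent_of_hodgeModel_holds
            cmAbelianVarietyEigenbasisRealised_holds)
          Literature.NumberTheory.Transcendental.arapura2012_cor_15_4_6_holds g z := fun z =>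
    (Literature.RepresentationTheory.Semisimple.ofModule'_apply_eq_of_smul (k := ℂ) (G := ↥(HodgeCM.HermSpace3.adelicFin V)) _ g z).trans
      (of_smul_eq_act _ _ _ _ _ g z)
  exact ((congrArg (conjT _ _ _ _ _ V) (h2 x)).trans (conjT_act _ _ _ _ _ g x)).trans (h2 _).symm

end Summit.HodgeConjecture.HodgeConjecture.Cruxes.H413.TowerConj

end
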